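import Summits.QuantumFields.YangMills.Theorems.BalabanUVNodesN19MGFFormKernelChain

/-!
# YM-DAG node N19 (= NE7 proper) — ROW MF-ID, GENERIC HALF (sibling): the kernel towers of `…N19MGFFormKernelChain` with a MEASURE-VALUED START
# `K 0 s y = ρ₀ y • δ_y` (the undressed start folded into the level-0 history measure), so that the kernel-dual class measure is `(μ.withDensity χ).bind (K n s)`
# with NO outer density — the start convention of a measure-valued slot recursion «level 0 = `b • δ_U`»

Cell `pub-ymgap`, HUMAN RULING D-0062 (Track A), R141 (C) wider-strategy seat `pub-ymgap-dag-n19-e` (strategy s3 = ALTERNATIVE CURRENCY).  Third file of the seat's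
GENERIC half (b) of ROW MF-ID (LENS decomp v5; dag-lead WORDS-125 ∕ 126 ∕ 131 ∕ 132, pub-ymgap INBOX l.15615 ∕ l.15621 ∕ l.15764 ∕ l.15837), a VARIANT of
`Summits/…/Theorems/BalabanUVNodesN19MGFFormKernelChain.lean` (p491035) for the other start convention.  That file characterises the history kernels by
`K 0 s = Kernel.id` and carries the undressed start `ρ₀` as a density both in the slot start (`T 0 s = ρ₀·g`) and OUTSIDE the class measure
(`((μ.withDensity χ).bind (K n s)).withDensity ρ₀`).  The AT-RECORD layer (c) (`dag-n19-d`, INTENT-18, INBOX l.15748 (i)) announced its measure-valued slot recursion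
with level 0 = `ofReal(boltzmann U) • δ_U`, i.e. the start INSIDE the level-0 measure; this file states the same four theorems for that convention so that (c) plugs in
with two `rfl`s whichever way it builds its recursion.  No statement of p491035 is repeated: the hypotheses (`hK0`), the slot starts and the class measures differ.

WHAT IS PROVED ([folklore] ∕ bookkeeping; Mathlib `Kernel`, `Measure.bind`, `withDensity`, `Measure.dirac`).  History kernels `K n s : Kernel (X n) (X 0)` with
`hK0 : ∀ s y, K 0 s y = ρ₀ y • Measure.dirac y` and `hKs : ∀ n s′, K (n+1) s′ = K n (init n s′) ∘ₖ κ n s′`: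
* `slotM_eq_lintegral` — a slot family with `T 0 s = ρ₀ · g` (measurable `g`) and `T (n+1) s′ = (y ↦ ∫⁻ T n (init s′) ∂κ n s′ y)` IS `y ↦ ∫⁻ g ∂(K n s y)`;
* `lintegral_mul_slotM_eq_lintegral_bind` — the class weight `∫⁻ χ·T n s dμ` is `∫⁻ g d((μ.withDensity χ).bind (K n s))`;
* `toReal_lintegral_mul_slotM_dressed_eq_mgf` — with `g = ofReal ∘ e^{tF}`: `(∫⁻ χ·T n s dμ).toReal = mgf F ((μ.withDensity χ).bind (K n s)) t` — the class measure
  `ν = (μ.withDensity χ).bind (K n s)`, t-free, NO outer density;  `bind_univ_eq_lintegral_undressed` ∕ `isFiniteMeasure_bind_of_lintegral_ne_top` (ν's mass is the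
  UNDRESSED class weight; ν finite iff that is);
* the junk-matched REAL bridge: `realSlotM_eq_toReal` (Bochner slots `Tr 0 s = (ρ₀ ·).toReal · gr`, `Tr (n+1) s′ y = ∫ Tr n (init s′) ∂(κ n s′ y)` ARE `toReal` of
  the `ℝ≥0∞` tower, the only proviso `hfin : ∫⁻ ofReal ∘ gr ∂(K n s y) ≠ ∞`) and `integral_mul_realSlotM_dressed_eq_mgf` (the BOCHNER class weight of the dressed real
  tower, `gr = e^{tF}`, `|F| ≤ B`, is `mgf F ((μ.withDensity (ofReal ∘ χ)).bind (K n s)) t` for measurable real `χ ≥ 0`, the proviso now `K n s y univ ≠ ∞` — FINITE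
  HISTORY MEASURES, (c)'s design (ii)); NO integrability binder anywhere;
* §3 `mgfForm_of_realKernelTowersM` — the one-line packaging of a run-indexed family of such REAL towers into `DressedMGFForm.MGFForm B Tcl F ν A`,
  `A K t τ := ∫ χ K τ · Tr K t (d K) (seq K τ) ∂μ K` (Bochner), `ν K τ := ((μ K).withDensity (ofReal ∘ χ K τ)).bind (Kh K (d K) (seq K τ))`.

HONEST FRAMING — what this is NOT.  `MGFForm` at the record NOT discharged here ((c)'s); nothing of Bałaban's instantiated; NE7 ∕ NE1′ NOT proved; N19 NOT discharged
(0∕1); K3‴ `SpineGivenEndpointR13` (stmt-QuantumFields-19912, route rev 16∕17) NOT claimed — `--supports … --as helper`; counts UNMOVED (discharged 5∕27).  No `def`,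
no `sorry`, no `axiom`, no `instance`, no `notation`.  One finite T⁴ programme at fixed `ε` — NOT ℝ⁴, NOT infinite volume, NOT OS, NOT a mass gap, NOT Clay.
-/

noncomputable section

namespace Summit.QuantumFields.YangMills.BalabanUVNodes.N19MGFFormKernelChainMeasureStart

open MeasureTheory ProbabilityTheory ProbabilityTheory.Kernel
open scoped ENNReal

variable {X : ℕ → Type*} [∀ n, MeasurableSpace (X n)] {ι : ℕ → Type*}
variable (init : ∀ n, ι (n + 1) → ι n) (κ : ∀ n, ι (n + 1) → Kernel (X (n + 1)) (X n)) {K : ∀ n, ι n → Kernel (X n) (X 0)}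
variable {ρ₀ : X 0 → ℝ≥0∞}

/-! ## §1 The `ℝ≥0∞` tower with measure-valued start -/

/-- **CHAIN LEMMA, measure-valued start.**  If `K 0 s y = ρ₀ y • δ_y` and `K (n+1) s′ = K n (init s′) ∘ₖ κ n s′`, a slot family starting at `ρ₀ · g` (measurable `g`)
and propagated by the step kernels IS `y ↦ ∫⁻ g ∂(K n s y)` (Mathlib `lintegral_smul_measure`, `lintegral_dirac'`, `Kernel.lintegral_comp`). [folklore] -/
theorem slotM_eq_lintegral (hK0 : ∀ s y, K 0 s y = ρ₀ y • Measure.dirac y) (hKs : ∀ n s', K (n + 1) s' = K n (init n s') ∘ₖ κ n s')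
    {T : ∀ n, ι n → X n → ℝ≥0∞} {g : X 0 → ℝ≥0∞} (hg : Measurable g) (h0 : ∀ s, T 0 s = fun y => ρ₀ y * g y)
    (hstep : ∀ n s', T (n + 1) s' = fun y => ∫⁻ x, T n (init n s') x ∂(κ n s' y)) :
    ∀ n s, T n s = fun y => ∫⁻ x, g x ∂(K n s y)
  | 0, s => by
      funext y
      rw [h0 s, hK0, lintegral_smul_measure, lintegral_dirac' _ hg, smul_eq_mul]
  | n + 1, s' => by
      have ih := slotM_eq_lintegral hK0 hKs hg h0 hstep n (init n s')
      funext y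
      rw [hstep n s', hKs, Kernel.lintegral_comp _ _ _ hg, ih]

/-- The class weight against a measurable front factor `χ` and a measure `μ` on level `n` is `∫⁻ g` against `(μ.withDensity χ).bind (K n s)`. [folklore] -/
theorem lintegral_mul_slotM_eq_lintegral_bind (hK0 : ∀ s y, K 0 s y = ρ₀ y • Measure.dirac y)
    (hKs : ∀ n s', K (n + 1) s' = K n (init n s') ∘ₖ κ n s') {T : ∀ n, ι n → X n → ℝ≥0∞} {g : X 0 → ℝ≥0∞} (hg : Measurable g)
    (h0 : ∀ s, T 0 s = fun y => ρ₀ y * g y) (hstep : ∀ n s', T (n + 1) s' = fun y => ∫⁻ x, T n (init n s') x ∂(κ n s' y)) (n : ℕ) (s : ι n)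
    (μ : Measure (X n)) {χ : X n → ℝ≥0∞} (hχ : Measurable χ) :
    ∫⁻ y, χ y * T n s y ∂μ = ∫⁻ x, g x ∂((μ.withDensity χ).bind (K n s)) := by
  rw [Measure.lintegral_bind (Kernel.aemeasurable _) hg.aemeasurable, lintegral_withDensity_eq_lintegral_mul _ hχ hg.lintegral_kernel]
  refine lintegral_congr fun y => ?_
  rw [slotM_eq_lintegral init κ hK0 hKs hg h0 hstep n s]
  rfl

/-- **THE MASS OF THE CLASS MEASURE IS THE UNDRESSED CLASS WEIGHT** (`g ≡ 1`): `((μ.withDensity χ).bind (K n s)) univ = ∫⁻ χ·T⁰ n s dμ` for the slot family started at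
`ρ₀`. [folklore] -/
theorem bind_univ_eq_lintegral_undressed (hK0 : ∀ s y, K 0 s y = ρ₀ y • Measure.dirac y)
    (hKs : ∀ n s', K (n + 1) s' = K n (init n s') ∘ₖ κ n s') {T₀ : ∀ n, ι n → X n → ℝ≥0∞} (h0 : ∀ s, T₀ 0 s = ρ₀)
    (hstep : ∀ n s', T₀ (n + 1) s' = fun y => ∫⁻ x, T₀ n (init n s') x ∂(κ n s' y)) (n : ℕ) (s : ι n) (μ : Measure (X n))
    {χ : X n → ℝ≥0∞} (hχ : Measurable χ) :
    (μ.withDensity χ).bind (K n s) Set.univ = ∫⁻ y, χ y * T₀ n s y ∂μ := by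
  have h0' : ∀ s, T₀ 0 s = fun y => ρ₀ y * (fun _ => (1 : ℝ≥0∞)) y := fun s => by rw [h0 s]; funext y; simp
  rw [lintegral_mul_slotM_eq_lintegral_bind init κ hK0 hKs measurable_const h0' hstep n s μ hχ, ← setLIntegral_one, Measure.restrict_univ]

/-- Hence the class measure is finite as soon as the UNDRESSED class weight is. [folklore] -/
theorem isFiniteMeasure_bind_of_lintegral_ne_top (hK0 : ∀ s y, K 0 s y = ρ₀ y • Measure.dirac y)
    (hKs : ∀ n s', K (n + 1) s' = K n (init n s') ∘ₖ κ n s') {T₀ : ∀ n, ι n → X n → ℝ≥0∞} (h0 : ∀ s, T₀ 0 s = ρ₀)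
    (hstep : ∀ n s', T₀ (n + 1) s' = fun y => ∫⁻ x, T₀ n (init n s') x ∂(κ n s' y)) (n : ℕ) (s : ι n) (μ : Measure (X n))
    {χ : X n → ℝ≥0∞} (hχ : Measurable χ) (hfin : ∫⁻ y, χ y * T₀ n s y ∂μ ≠ ∞) :
    IsFiniteMeasure ((μ.withDensity χ).bind (K n s)) :=
  ⟨by rw [bind_univ_eq_lintegral_undressed init κ hK0 hKs h0 hstep n s μ hχ]; exact hfin.lt_top⟩

/-- **MGF FORM OF EVERY HISTORY, measure-valued start.**  With the dressing `g = ofReal ∘ e^{tF}` (measurable `F`):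
`(∫⁻ χ·T n s dμ).toReal = mgf F ((μ.withDensity χ).bind (K n s)) t` — the kernel-dual class measure with NO outer density, t-free. [folklore] -/
theorem toReal_lintegral_mul_slotM_dressed_eq_mgf (hK0 : ∀ s y, K 0 s y = ρ₀ y • Measure.dirac y)
    (hKs : ∀ n s', K (n + 1) s' = K n (init n s') ∘ₖ κ n s') {F : X 0 → ℝ} (hF : Measurable F) (t : ℝ) {T : ∀ n, ι n → X n → ℝ≥0∞}
    (h0 : ∀ s, T 0 s = fun y => ρ₀ y * ENNReal.ofReal (Real.exp (t * F y)))
    (hstep : ∀ n s', T (n + 1) s' = fun y => ∫⁻ x, T n (init n s') x ∂(κ n s' y)) (n : ℕ) (s : ι n) (μ : Measure (X n))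
    {χ : X n → ℝ≥0∞} (hχ : Measurable χ) :
    (∫⁻ y, χ y * T n s y ∂μ).toReal = mgf F ((μ.withDensity χ).bind (K n s)) t := by
  have hw : Measurable fun x => ENNReal.ofReal (Real.exp (t * F x)) :=
    ENNReal.measurable_ofReal.comp (Real.measurable_exp.comp (hF.const_mul t))
  rw [lintegral_mul_slotM_eq_lintegral_bind init κ hK0 hKs hw h0 hstep n s μ hχ, mgf,
    integral_eq_lintegral_of_nonneg_ae (ae_of_all _ fun x => (Real.exp_pos _).le)
      (Real.measurable_exp.comp (hF.const_mul t)).aestronglyMeasurable]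

/-! ## §2 The junk-matched real bridge with measure-valued start -/

/-- **REAL BRIDGE, measure-valued start.**  Bochner slots `Tr 0 s = (ρ₀ ·).toReal · gr` (measurable real `gr ≥ 0`), `Tr (n+1) s′ y = ∫ Tr n (init s′) ∂(κ n s′ y)`, with
`∫⁻ ofReal ∘ gr ∂(K n s y) ≠ ∞` for every history: `Tr n s = fun y => (∫⁻ ofReal ∘ gr ∂(K n s y)).toReal` — no integrability binder (def-T's `toReal ∞ = 0`
convention matched by `hfin`). [folklore] -/
theorem realSlotM_eq_toReal (hK0 : ∀ s y, K 0 s y = ρ₀ y • Measure.dirac y) (hKs : ∀ n s', K (n + 1) s' = K n (init n s') ∘ₖ κ n s')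
    {Tr : ∀ n, ι n → X n → ℝ} {gr : X 0 → ℝ} (hgr : Measurable gr) (hgr0 : ∀ x, 0 ≤ gr x)
    (hfin : ∀ n s y, ∫⁻ x, ENNReal.ofReal (gr x) ∂(K n s y) ≠ ∞)
    (h0 : ∀ s, Tr 0 s = fun y => (ρ₀ y).toReal * gr y)
    (hstep : ∀ n s' y, Tr (n + 1) s' y = ∫ x, Tr n (init n s') x ∂(κ n s' y)) :
    ∀ n s, Tr n s = fun y => (∫⁻ x, ENNReal.ofReal (gr x) ∂(K n s y)).toReal
  | 0, s => by
      have hg : Measurable fun x => ENNReal.ofReal (gr x) := ENNReal.measurable_ofReal.comp hgr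
      funext y
      rw [h0 s, hK0, lintegral_smul_measure, lintegral_dirac' _ hg, smul_eq_mul, ENNReal.toReal_mul,
        ENNReal.toReal_ofReal (hgr0 y)]
  | n + 1, s' => by
      have hg : Measurable fun x => ENNReal.ofReal (gr x) := ENNReal.measurable_ofReal.comp hgr
      have ih := realSlotM_eq_toReal hK0 hKs hgr hgr0 hfin h0 hstep n (init n s')
      have hL : Measurable fun x => ∫⁻ z, ENNReal.ofReal (gr z) ∂(K n (init n s') x) := hg.lintegral_kernel
      funext y
      have hnn : 0 ≤ᵐ[κ n s' y] Tr n (init n s') := ae_of_all _ fun x => by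
        show (0 : ℝ) ≤ Tr n (init n s') x
        rw [ih]; exact ENNReal.toReal_nonneg
      have hsm : AEStronglyMeasurable (Tr n (init n s')) (κ n s' y) := by
        rw [ih]; exact hL.ennreal_toReal.aestronglyMeasurable
      rw [hstep n s' y, integral_eq_lintegral_of_nonneg_ae hnn hsm, hKs, Kernel.lintegral_comp _ _ _ hg]
      congr 1
      refine lintegral_congr fun x => ?_
      rw [ih]
      exact ENNReal.ofReal_toReal (hfin n (init n s') x)

omit [∀ n, MeasurableSpace (X n)] in
/-- A finite history measure gives the dressing `e^{tF}`, `|F| ≤ B`, finite mass. [folklore] -/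
theorem lintegral_exp_ne_top_of_univ_ne_top {mX : MeasurableSpace (X 0)} {F : X 0 → ℝ} {B : ℝ} (hFb : ∀ x, |F x| ≤ B) (t : ℝ)
    (ν : Measure (X 0)) (hν : ν Set.univ ≠ ∞) : ∫⁻ x, ENNReal.ofReal (Real.exp (t * F x)) ∂ν ≠ ∞ := by
  have hle : ∀ x, ENNReal.ofReal (Real.exp (t * F x)) ≤ ENNReal.ofReal (Real.exp (|t| * B)) := fun x =>
    ENNReal.ofReal_le_ofReal (Real.exp_le_exp.mpr (by
      calc t * F x ≤ |t * F x| := le_abs_self _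
        _ = |t| * |F x| := abs_mul _ _
        _ ≤ |t| * B := mul_le_mul_of_nonneg_left (hFb x) (abs_nonneg t)))
  refine ne_top_of_le_ne_top ?_ (lintegral_mono hle)
  rw [MeasureTheory.lintegral_const]
  exact ENNReal.mul_ne_top ENNReal.ofReal_ne_top hν

/-- **THE BOCHNER CLASS WEIGHT OF THE DRESSED REAL TOWER IS THE MGF, measure-valued start.**  Real slots started at `(ρ₀ y).toReal · e^{t F y}` (measurable `F`,
`|F| ≤ B`), propagated by Bochner integration against the step kernels, FINITE history measures (`K n s y univ ≠ ∞`, t-free); then for measurable real `χ ≥ 0` and any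
`μ` on level `n`: `∫ χ·Tr n s dμ = mgf F ((μ.withDensity (ofReal ∘ χ)).bind (K n s)) t` — both sides `0` together when infinite.  No integrability binder. [folklore] -/
theorem integral_mul_realSlotM_dressed_eq_mgf (hK0 : ∀ s y, K 0 s y = ρ₀ y • Measure.dirac y)
    (hKs : ∀ n s', K (n + 1) s' = K n (init n s') ∘ₖ κ n s') {F : X 0 → ℝ} (hF : Measurable F) {B : ℝ} (hFb : ∀ x, |F x| ≤ B) (t : ℝ)
    (hKfin : ∀ n s y, K n s y Set.univ ≠ ∞) {Tr : ∀ n, ι n → X n → ℝ}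
    (h0 : ∀ s, Tr 0 s = fun y => (ρ₀ y).toReal * Real.exp (t * F y))
    (hstep : ∀ n s' y, Tr (n + 1) s' y = ∫ x, Tr n (init n s') x ∂(κ n s' y)) (n : ℕ) (s : ι n) (μ : Measure (X n))
    {χ : X n → ℝ} (hχ : Measurable χ) (hχ0 : ∀ y, 0 ≤ χ y) :
    ∫ y, χ y * Tr n s y ∂μ = mgf F ((μ.withDensity fun y => ENNReal.ofReal (χ y)).bind (K n s)) t := by
  have hgr : Measurable fun x => Real.exp (t * F x) := Real.measurable_exp.comp (hF.const_mul t)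
  have hg : Measurable fun x => ENNReal.ofReal (Real.exp (t * F x)) := ENNReal.measurable_ofReal.comp hgr
  have hfin : ∀ n s y, ∫⁻ x, ENNReal.ofReal (Real.exp (t * F x)) ∂(K n s y) ≠ ∞ := fun n s y =>
    lintegral_exp_ne_top_of_univ_ne_top hFb t _ (hKfin n s y)
  have hbr := realSlotM_eq_toReal init κ hK0 hKs hgr (fun x => (Real.exp_pos _).le) hfin h0 hstep n s
  -- the canonical `ℝ≥0∞` tower `y ↦ ∫⁻ ofReal ∘ e^{tF} ∂(K n s y)` satisfies the start ∕ step equations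
  have hT0 : ∀ s : ι 0, (fun y => ∫⁻ x, ENNReal.ofReal (Real.exp (t * F x)) ∂(K 0 s y))
      = fun y => ρ₀ y * ENNReal.ofReal (Real.exp (t * F y)) := fun s => by
    funext y
    rw [hK0, lintegral_smul_measure, lintegral_dirac' _ hg, smul_eq_mul]
  have hTs : ∀ n (s' : ι (n + 1)), (fun y => ∫⁻ x, ENNReal.ofReal (Real.exp (t * F x)) ∂(K (n + 1) s' y))
      = fun y => ∫⁻ x, (fun z => ∫⁻ x, ENNReal.ofReal (Real.exp (t * F x)) ∂(K n (init n s') z)) x ∂(κ n s' y) := fun n s' => by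
    funext y
    rw [hKs, Kernel.lintegral_comp _ _ _ hg]
  have hχ' : Measurable (fun y => ENNReal.ofReal (χ y)) := ENNReal.measurable_ofReal.comp hχ
  have hmgf := toReal_lintegral_mul_slotM_dressed_eq_mgf init κ hK0 hKs hF t
    (T := fun n s y => ∫⁻ x, ENNReal.ofReal (Real.exp (t * F x)) ∂(K n s y)) hT0 hTs n s μ hχ'
  rw [← hmgf]
  have hnn : 0 ≤ᵐ[μ] fun y => χ y * Tr n s y := ae_of_all _ fun y => by
    show (0 : ℝ) ≤ χ y * Tr n s y
    refine mul_nonneg (hχ0 y) ?_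
    rw [hbr]; exact ENNReal.toReal_nonneg
  have hsm : AEStronglyMeasurable (fun y => χ y * Tr n s y) μ := by
    rw [hbr]
    exact (hχ.mul (hg.lintegral_kernel).ennreal_toReal).aestronglyMeasurable
  rw [integral_eq_lintegral_of_nonneg_ae hnn hsm]
  congr 1
  refine lintegral_congr fun y => ?_
  rw [ENNReal.ofReal_mul (hχ0 y), hbr]
  exact congrArg _ (ENNReal.ofReal_toReal (hfin n s y))

/-! ## §3 Packaging a run-indexed family of REAL (Bochner) towers with measure-valued start into `DressedMGFForm.MGFForm` -/

section Packaging

open Summit.QuantumFields.BalabanUV.T4Continuum.NE1p.DressedMGFForm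

/-- **`MGFForm` FROM REAL KERNEL TOWERS, measure-valued start — the one-line packaging for a Bochner consumer.**  Per run `K`: parent maps, t-free step kernels,
history kernels `Kh K` with `Kh K 0 s y = ρ₀ K y • δ_y` and the composition equation, FINITE history measures, an observable `|F K| ≤ B`, a depth `d K`, a decoding
`seq K` of the classes, a reference measure `μ K` and measurable real front factors `χ K τ ≥ 0` on level `d K`, REAL slot families `Tr K t` started at
`(ρ₀ K ·).toReal · e^{t F K}` and propagated by Bochner integration, finite class measures; the dressed class terms `A K t τ` being the Bochner class weights.  Then
`MGFForm B Tcl F ν A` with `ν K τ = ((μ K).withDensity (ofReal ∘ χ K τ)).bind (Kh K (d K) (seq K τ))` EXPLICIT and t-free — no integrability binder. [folklore] -/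
theorem mgfForm_of_realKernelTowersM {X : ℕ → ℕ → Type*} [∀ K n, MeasurableSpace (X K n)] {ι : ℕ → ℕ → Type*} {ι' : Type*} {B : ℝ}
    (hB : 0 ≤ B) (Tcl : ℕ → Finset ι') (init : ∀ K n, ι K (n + 1) → ι K n) (κ : ∀ K n, ι K (n + 1) → Kernel (X K (n + 1)) (X K n))
    {Kh : ∀ K n, ι K n → Kernel (X K n) (X K 0)} {ρ₀ : ∀ K, X K 0 → ℝ≥0∞} (hK0 : ∀ K s y, Kh K 0 s y = ρ₀ K y • Measure.dirac y)
    (hKs : ∀ K n s', Kh K (n + 1) s' = Kh K n (init K n s') ∘ₖ κ K n s') {F : ∀ K, X K 0 → ℝ} (hFm : ∀ K, Measurable (F K))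
    (hFb : ∀ K x, |F K x| ≤ B) (hKfin : ∀ K n s y, Kh K n s y Set.univ ≠ ∞) (d : ℕ → ℕ) (seq : ∀ K, ι' → ι K (d K))
    (μ : ∀ K, Measure (X K (d K))) {χ : ∀ K, ι' → X K (d K) → ℝ} (hχ : ∀ K τ, Measurable (χ K τ)) (hχ0 : ∀ K τ y, 0 ≤ χ K τ y)
    {Tr : ∀ K, ℝ → ∀ n, ι K n → X K n → ℝ} (h0 : ∀ K t s, Tr K t 0 s = fun y => (ρ₀ K y).toReal * Real.exp (t * F K y))
    (hstep : ∀ K t n s' y, Tr K t (n + 1) s' y = ∫ x, Tr K t n (init K n s') x ∂(κ K n s' y))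
    (hfin : ∀ K, ∀ τ ∈ Tcl K, ((μ K).withDensity fun y => ENNReal.ofReal (χ K τ y)).bind (Kh K (d K) (seq K τ)) Set.univ ≠ ∞)
    {A : ℕ → ℝ → ι' → ℝ} (hA : ∀ K t, ∀ τ ∈ Tcl K, A K t τ = ∫ y, χ K τ y * Tr K t (d K) (seq K τ) y ∂μ K) :
    MGFForm B Tcl F (fun K τ => ((μ K).withDensity fun y => ENNReal.ofReal (χ K τ y)).bind (Kh K (d K) (seq K τ))) A where
  nonneg := hB
  meas := hFm
  bound := hFb
  finite := fun K τ hτ => ⟨(hfin K τ hτ).lt_top⟩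
  repr := fun K t τ hτ => by
    rw [hA K t τ hτ]
    exact integral_mul_realSlotM_dressed_eq_mgf (init K) (κ K) (hK0 K) (hKs K) (hFm K) (hFb K) t (hKfin K) (h0 K t) (hstep K t)
      (d K) (seq K τ) (μ K) (hχ K τ) (hχ0 K τ)

end Packaging

end Summit.QuantumFields.YangMills.BalabanUVNodes.N19MGFFormKernelChainMeasureStart

end
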